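import Summits.ResolutionOfSingularities.ResolutionOfSingularities.Theorems.MarkedTransferCampaignW46ThreefoldsGammaFreeGlobalSmoothOrder
import Summits.ResolutionOfSingularities.ResolutionOfSingularities.Theorems.MarkedTransferCampaignW46HostLadder
import Literature.AlgebraicGeometry.Resolution.HasSNCFieldBaseChange
import Literature.AlgebraicGeometry.Resolution.StalkIdealLemmas
import Literature.AlgebraicGeometry.Resolution.BlowupsFlatBaseChange
import Literature.AlgebraicGeometry.Resolution.MarkedResolutions
import HarnessLib

/-!
# [OURS · L1 W4.6 rung (ii)] SMOOTH FUNCTORIALITY OF THE HOST SHAPE — simple normal crossings, BGMW multiple blow-ups and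
# marked resolutions pull back along SMOOTH morphisms; the conclusion of stmt-16156 / of `HypersurfaceOrderReductionDimLE p d`
# transfers to every smooth pull-back of an input, PROVED

Cell res-hironaka, LADDER-RESOLUTION rung L (D-0089), slot W4.6, rung (ii) (threefold hypersurfaces); seat res-L1-s46-pv-3
(gen 3). Host route MarkedTransfer, host item `HypersurfaceOrderReductionDimLeThree` (stmt-ResolutionOfSingularities-16156);
host-shape ladder `CampaignW46.HypersurfaceOrderReductionDimLE p d` (typer res-L1-type-o1, `…W46HostLadder.lean` p500045,
route-independent; `d = 1` proved by res-L1-s46-pv-10). Filed `--kind proof --supports` stmt-16156 `--as helper`.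
Everything here is OURS: kernel theorems over PROVED tree lemmas; NOTHING is a statement of Hironaka's manuscript; no typed
`Hironaka2017` candidate enters; no named FACT is a hypothesis. AI-written; AI review is weaker than expert review.
Companion of `…ThreefoldsGammaFreeGlobalSmooth[Order].lean` (the Γ-free shape).

## What is proved (no new definitions)

* §1 `CampaignW46.HasSNCWith.comap_of_smooth` — **simple normal crossings (boundary + centre) pull back along SMOOTH
  morphisms** (the tree had étale morphisms, `HasSNCWith.comap_of_etale`, and base-field extensions,
  `HasSNCWith.comap_pullback_fst_field`; the local algebra — flat local homomorphism with regular closed fibre, Matsumura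
  15.1 / 23.7 — is the latter's, run for an arbitrary smooth morphism with the regular fibre supplied by
  `isRegularLocalRing_fibre_stalkMap_of_smooth`); `CampaignW46.HasSNC.comap_of_smooth`.
* §2 `CampaignW46.IsMultipleBlowup.exists_isPullback_of_smooth`,
  `CampaignW46.IsMarkedResolution.exists_isPullback_of_smooth` — **BGMW Thm. 8.0.5 for smooth morphisms**: the fibre
  product of a multiple blow-up / marked resolution of `(X, 𝓘, E, μ)` with a smooth `X′ → X` is one of
  `(X′, φ^*𝓘, φ^*E, μ)`.
* §3 `CampaignW46.hostConclusion_comap_of_smooth` — **the CONCLUSION OF stmt-16156 transfers along smooth morphisms**: if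
  `(X, I, E, m)` has a BGMW marked resolution then so does `(X′, φ^*I, φ^*E, m)` for every smooth `φ : X′ ⟶ X`; and the
  TRANSFER PRINCIPLE for the host-shape ladder `CampaignW46.hostConclusion_of_smooth_over_rung :
  HypersurfaceOrderReductionDimLE p d → (rung-d input (X, I, E)) → (φ : X′ ⟶ X) [Smooth φ] → 1 ≤ m → ∃ X″ Φ M′,
  IsMarkedResolution ⟨φ^*I, φ^*E, m⟩ Φ M′` — with the proved host rung `d = 1` (res-L1-s46-pv-10) every smooth pull-back of
  a curve input (with pulled-back boundary) is settled in the host's sense; with `d = 2` every cylinder over a surface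
  input will be.

HONEST VALUE. Structure, not a rung: the host item's conclusion is stable under smooth base change (downward); no descent
is claimed. §1 is bookkeeping of independent use (SNC boundaries on `X × 𝔸ⁿ`, on smooth families).

References: `…ThreefoldsGammaFreeGlobalSmoothOrder.lean` (p503120: fibre regularity, order preservation, regular centres),
`…W46HostLadder.lean` (p500045); tree `Resolution/HasSNCFieldBaseChange.lean` (pattern of `HasSNCWith.comap_pullback_fst_field`
[Matsumura1987, Thm. 15.1, Thm. 23.7]), `Resolution/NormalCrossingsBlowupStepReduction.lean`
(`isRsopPart_of_isRegularLocalRing_zero`), `Resolution/SemiStablePairFieldBaseChange.lean` (`mem_maximalIdeal_iff_mk_mem`),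
`Resolution/SmoothUniformizationProofs.lean` (`ringKrullDim_eq_add_of_flat` [Matsumura1987, Thm. 15.1]),
`Resolution/AlterationsLemma32.lean` (`isRegularLocalRing_stalk_of_smooth` [Grothendieck1967, Prop. 17.5.8 (iii)]),
`Resolution/MarkedIdealsEtale.lean` (`MarkedIdeal.transform_comap_of_flat`, pattern `IsMultipleBlowup.exists_isPullback_of_etale`
[BierstoneGrigorievMilmanWlodarczyk2011, Thm. 8.0.5]), `Resolution/BlowupsFlatBaseChange.lean` (`IsBlowup.of_isPullback_of_flat`
[GortzWedhorn2020, Prop. 13.91]), `Resolution/MarkedResolutions.lean` (`IsMultipleBlowup.isLocallyNoetherian`),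
`Resolution/StalkIdealLemmas.lean` (`stalkIdeal_comap_eq_map_stalkMap`). H. Hironaka, ms. 2017-03-23 — scope only, under
adjudication, not cited as fact. [Hironaka2017]
-/

noncomputable section

set_option linter.dupNamespace false -- mandated namespace of this single-conjunct summit

open CategoryTheory CategoryTheory.Limits AlgebraicGeometry TopologicalSpace IsLocalRing

namespace Summit.ResolutionOfSingularities.ResolutionOfSingularities.Theorems

namespace CampaignW46

open Literature.AlgebraicGeometry.Resolution
open Scheme.IdealSheafData

universe u

/-! ## §1 Simple normal crossings pull back along smooth morphisms -/
/-- **SIMPLE NORMAL CROSSINGS (WITH A CENTRE) PULL BACK ALONG SMOOTH MORPHISMS**: if the boundary `E` and the centre `C`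
have simple normal crossings on `X` (`HasSNCWith E C`: at each point a regular system of parameters of which the members of
`E` through the point are distinct coordinates and `C` is a coordinate subspace) and `φ : X′ ⟶ X` is smooth (`X` locally
Noetherian), then `φ^*E`, `φ^*C` have simple normal crossings on `X′`. At `p ↦ φ p`: the stalk map `A → B` is flat and
local with REGULAR closed fibre `F = B/𝔪_A B` (`isRegularLocalRing_fibre_stalkMap_of_smooth`), `B` is regular (EGA IV
17.5.8 (iii)), `dim B = dim A + dim F` (Matsumura 15.1), so the images of the adapted regular system of parameters of
`A` together with lifts of a regular system of parameters of `F` form a regular system of parameters of `B`, adapted to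
the pulled-back divisors and centre (stalks of pulled-back ideal sheaves are extended stalks). The proof is the tree's
`HasSNCWith.comap_pullback_fst_field` (base-field extension) run for an arbitrary smooth morphism.
[cite: Matsumura1987, Thm. 15.1 and Thm. 23.7] -/
theorem HasSNCWith.comap_of_smooth {X' X : Scheme.{u}} (φ : X' ⟶ X) [Smooth φ] [IsLocallyNoetherian X]
    {E : List X.IdealSheafData} {C : X.IdealSheafData} (h : HasSNCWith E C) :
    HasSNCWith (E.map fun D => D.comap φ) (C.comap φ) := by
  classical
  haveI : IsLocallyNoetherian X' := LocallyOfFiniteType.isLocallyNoetherian φ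
  intro p
  obtain ⟨hregy, u, hu, ⟨ι, hι, hιD⟩, hC⟩ := h (φ p)
  -- the flat local homomorphism `A = 𝒪_{X,φ p} → B = 𝒪_{X',p}`, its regular fibre ring `F`
  letI : Algebra (X.presheaf.stalk (φ p)) (X'.presheaf.stalk p) := (φ.stalkMap p).hom.toAlgebra
  haveI : Module.Flat (X.presheaf.stalk (φ p)) (X'.presheaf.stalk p) := Flat.stalkMap φ p
  haveI hφloc : IsLocalHom (algebraMap (X.presheaf.stalk (φ p)) (X'.presheaf.stalk p)) :=
    inferInstanceAs (IsLocalHom (φ.stalkMap p).hom)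
  haveI : IsRegularLocalRing (X.presheaf.stalk (φ p)) := hregy
  haveI hBreg : IsRegularLocalRing (X'.presheaf.stalk p) := isRegularLocalRing_stalk_of_smooth φ p hregy
  haveI hFreg : IsRegularLocalRing (X'.presheaf.stalk p ⧸ (maximalIdeal (X.presheaf.stalk (φ p))).map
      (algebraMap (X.presheaf.stalk (φ p)) (X'.presheaf.stalk p))) :=
    isRegularLocalRing_fibre_stalkMap_of_smooth φ p
  have hdimB := ringKrullDim_eq_add_of_flat (R := X.presheaf.stalk (φ p)) (S := X'.presheaf.stalk p)
  set ψ := algebraMap (X.presheaf.stalk (φ p)) (X'.presheaf.stalk p) with hψ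
  set IF := (maximalIdeal (X.presheaf.stalk (φ p))).map ψ with hIF
  haveI hFloc : IsLocalRing (X'.presheaf.stalk p ⧸ IF) := by rw [hIF]; infer_instance
  haveI hFreg' : IsRegularLocalRing (X'.presheaf.stalk p ⧸ IF) := by rw [hIF]; exact hFreg
  -- dimensions: `dim A = d := spanFinrank 𝔪_A`, `dim F = eF`, `dim B = d + eF`
  have hdimA : ringKrullDim (X.presheaf.stalk (φ p)) =
      ((maximalIdeal (X.presheaf.stalk (φ p))).spanFinrank : WithBot ℕ∞) :=
    (IsRegularLocalRing.spanFinrank_maximalIdeal (R := X.presheaf.stalk (φ p))).symm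
  obtain ⟨-, eF, w, hdimF, hspanF⟩ :=
    isRsopPart_of_isRegularLocalRing_zero (R := X'.presheaf.stalk p ⧸ IF) Fin.elim0
  rw [Set.range_eq_empty, Set.empty_union] at hspanF
  rw [Nat.zero_add] at hdimF
  choose wl hwl using fun j => Ideal.Quotient.mk_surjective (I := IF) (w j)
  have hwl' : (Ideal.Quotient.mk IF) ∘ wl = w := funext hwl
  have hmA : IF = Ideal.span (Set.range (ψ ∘ u)) := by
    rw [hIF, Set.range_comp, ← Ideal.map_span, hu]
  have hIFle : IF ≤ maximalIdeal (X'.presheaf.stalk p) :=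
    ((local_hom_TFAE ψ).out 0 2).mp hφloc
  -- `(ψ u, wl)` generate `𝔪_B`
  have hgen : Ideal.span (Set.range (Fin.append (ψ ∘ u) wl)) = maximalIdeal (X'.presheaf.stalk p) := by
    rw [range_fin_append, Ideal.span_union, ← hmA]
    apply le_antisymm
    · refine sup_le hIFle ?_
      rw [Ideal.span_le]
      rintro _ ⟨j, rfl⟩
      rw [SetLike.mem_coe, mem_maximalIdeal_iff_mk_mem (I := IF), hwl, ← hspanF]
      exact Ideal.subset_span ⟨j, rfl⟩
    · intro m hm
      have h1 : Ideal.Quotient.mk IF m ∈ (Ideal.span (Set.range wl)).map (Ideal.Quotient.mk IF) := by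
        rw [Ideal.map_span, ← Set.range_comp, hwl', hspanF]
        exact (mem_maximalIdeal_iff_mk_mem (I := IF) m).mp hm
      have h2 : m ∈ ((Ideal.span (Set.range wl)).map (Ideal.Quotient.mk IF)).comap
          (Ideal.Quotient.mk IF) := h1
      rw [Ideal.comap_map_of_surjective _ Ideal.Quotient.mk_surjective, ← RingHom.ker_eq_comap_bot,
        Ideal.mk_ker] at h2
      rw [sup_comm]
      exact h2
  have hdimB' : ringKrullDim (X'.presheaf.stalk p) =
      (((maximalIdeal (X.presheaf.stalk (φ p))).spanFinrank + eF : ℕ) : WithBot ℕ∞) := by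
    rw [hdimB, hdimA, hdimF]
    push_cast
    rfl
  -- hence `spanFinrank 𝔪_B = d + eF` (`B` is regular)
  have heq : (maximalIdeal (X'.presheaf.stalk p)).spanFinrank =
      (maximalIdeal (X.presheaf.stalk (φ p))).spanFinrank + eF := by
    have h1 := IsRegularLocalRing.spanFinrank_maximalIdeal (R := X'.presheaf.stalk p)
    rw [hdimB'] at h1
    exact_mod_cast h1
  -- the regular system of parameters of `B`, indexed by `Fin (spanFinrank 𝔪_B)`
  let g : Fin (maximalIdeal (X'.presheaf.stalk p)).spanFinrank →
      Fin ((maximalIdeal (X.presheaf.stalk (φ p))).spanFinrank + eF) := fun i => i.cast heq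
  have hg : Function.Surjective g := fun j => ⟨j.cast heq.symm, by simp [g]⟩
  let u' : Fin (maximalIdeal (X'.presheaf.stalk p)).spanFinrank → X'.presheaf.stalk p :=
    Fin.append (ψ ∘ u) wl ∘ g
  have hu'cast : ∀ i : Fin (maximalIdeal (X.presheaf.stalk (φ p))).spanFinrank,
      u' ((Fin.castAdd eF i).cast heq.symm) = ψ (u i) := by
    intro i
    change Fin.append (ψ ∘ u) wl (((Fin.castAdd eF i).cast heq.symm).cast heq) = _
    have hcc : ((Fin.castAdd eF i).cast heq.symm).cast heq = Fin.castAdd eF i := by simp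
    rw [hcc, Fin.append_left]
    rfl
  refine ⟨hBreg, u', ?_, ?_, ?_⟩
  · -- `span (range u') = 𝔪_B`
    change Ideal.span (Set.range (Fin.append (ψ ∘ u) wl ∘ g)) = _
    rw [hg.range_comp]
    exact hgen
  · -- the divisors through `p`
    have hex : ∀ D' : {D' // D' ∈ (E.map fun D => D.comap φ) ∧ p ∈ D'.support},
        ∃ D : X.IdealSheafData, D ∈ E ∧ D.comap φ = D'.1 := fun D' => List.mem_map.1 D'.2.1
    choose Dof hDofE hDof using hex
    have hmem : ∀ D' : {D' // D' ∈ (E.map fun D => D.comap φ) ∧ p ∈ D'.support},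
        φ p ∈ (Dof D').support := by
      intro D'
      have h1 : p ∈ ((Dof D').comap φ).support := by rw [hDof D']; exact D'.2.2
      rw [Scheme.IdealSheafData.support_comap] at h1
      exact h1
    refine ⟨fun D' => (Fin.castAdd eF (ι ⟨Dof D', hDofE D', hmem D'⟩)).cast heq.symm, ?_, ?_⟩
    · intro D₁ D₂ h12
      have h1 : Fin.castAdd eF (ι ⟨Dof D₁, hDofE D₁, hmem D₁⟩) =
          Fin.castAdd eF (ι ⟨Dof D₂, hDofE D₂, hmem D₂⟩) := Fin.cast_injective heq.symm h12
      have h2 := hι (Fin.castAdd_injective _ _ h1)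
      have h3 : Dof D₁ = Dof D₂ := congrArg (fun D : {D // D ∈ E ∧ φ p ∈ D.support} => D.1) h2
      apply Subtype.ext
      rw [← hDof D₁, ← hDof D₂, h3]
    · intro D'
      rw [hu'cast]
      have h1 : stalkIdeal D'.1 p = stalkIdeal ((Dof D').comap φ) p := by rw [hDof D']
      rw [h1, stalkIdeal_comap_eq_map_stalkMap, hιD ⟨Dof D', hDofE D', hmem D'⟩, Ideal.map_span,
        Set.image_singleton]
      rfl
  · -- the centre
    intro hp
    have hp' : φ p ∈ C.support := by
      rw [Scheme.IdealSheafData.support_comap] at hp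
      exact hp
    obtain ⟨S, hS⟩ := hC hp'
    refine ⟨(fun i : Fin (maximalIdeal (X.presheaf.stalk (φ p))).spanFinrank =>
      (Fin.castAdd eF i).cast heq.symm) '' S, ?_⟩
    rw [stalkIdeal_comap_eq_map_stalkMap, hS, Ideal.map_span, Set.image_image, Set.image_image]
    congr 1
    refine Set.image_congr' fun i => ?_
    rw [hu'cast]
    rfl

/-- **Simple normal crossings (no centre) pull back along smooth morphisms** (the case `C = ⊤`).
[cite: Matsumura1987, Thm. 15.1 and Thm. 23.7] -/
theorem HasSNC.comap_of_smooth {X' X : Scheme.{u}} (φ : X' ⟶ X) [Smooth φ] [IsLocallyNoetherian X]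
    {E : List X.IdealSheafData} (h : HasSNC E) : HasSNC (E.map fun D => D.comap φ) := by
  have h1 := HasSNCWith.comap_of_smooth φ h
  rwa [Scheme.IdealSheafData.comap_top] at h1

/-! ## §2 Multiple blow-ups and marked resolutions pull back along smooth morphisms -/

section Pullback

variable {X' X : Scheme.{u}} (φ : X' ⟶ X) [Smooth φ] [IsLocallyNoetherian X]

/-- **SMOOTH PULL-BACK OF A BGMW MULTIPLE BLOW-UP** (Thm. 8.0.5 for smooth instead of étale morphisms): if `σ : Z ⟶ X`
is a multiple blow-up of the marked ideal `(X, 𝓘, E, μ)` with final marked ideal `(Z, 𝓘_r, E_r, μ)` and `φ : X′ ⟶ X` is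
smooth (`X` locally Noetherian), then the fibre product `Z′ = Z ×_X X′ ⟶ X′`, built step by step
(`Bl_{ψᵢ^*Cᵢ} = Bl_{Cᵢ} ×_{Xᵢ} X′ᵢ`, blow-ups commute with flat base change), is a multiple blow-up of
`φ^*(X, 𝓘, E, μ) = (X′, φ^*𝓘, φ^*E, μ)` with final marked ideal `ψ^*(Z, 𝓘_r, E_r, μ)`, `ψ : Z′ ⟶ Z` the smooth projection:
pulled-back centres are regular (`Scheme.IsRegular.subscheme_comap_of_smooth`), lie in the support
(smooth morphisms preserve orders, `le_idealOrder_comap_iff_of_smooth`), have simple normal crossings with the pulled-back boundary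
(`HasSNCWith.comap_of_smooth`), and the transforms are the pulled-back transforms (`MarkedIdeal.transform_comap_of_flat`).
[cite: BierstoneGrigorievMilmanWlodarczyk2011, Thm. 8.0.5 (1)–(2) with Def. 3.1.3] -/
theorem IsMultipleBlowup.exists_isPullback_of_smooth {M : MarkedIdeal X} {Z : Scheme.{u}}
    {σ : Z ⟶ X} {N : MarkedIdeal Z} (h : IsMultipleBlowup M σ N) :
    ∃ (Z' : Scheme.{u}) (σ' : Z' ⟶ X') (ψ : Z' ⟶ Z), IsPullback ψ σ' σ φ ∧ Smooth ψ ∧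
      IsMultipleBlowup (⟨M.ideal.comap φ, M.boundary.map (·.comap φ), M.mult⟩ : MarkedIdeal X') σ'
        ⟨N.ideal.comap ψ, N.boundary.map (·.comap ψ), N.mult⟩ := by
  induction h with
  | refl =>
    exact ⟨X', 𝟙 X', φ, IsPullback.of_vert_isIso ⟨by simp⟩, inferInstance, IsMultipleBlowup.refl _⟩
  | @blowup Z₀ Z₁ σ₀ N₀ h₀ C τ hτ hC hsupp hsnc' ih =>
    obtain ⟨Z₀', σ₀', ψ₀, hpb₀, hsm, hmb⟩ := ih
    haveI := hsm
    haveI : IsLocallyNoetherian Z₀ := h₀.isLocallyNoetherian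
    haveI : IsLocallyNoetherian Z₁ := (h₀.blowup C τ hτ hC hsupp hsnc').isLocallyNoetherian
    haveI : IsLocallyNoetherian Z₀' := LocallyOfFiniteType.isLocallyNoetherian ψ₀
    haveI : Smooth (pullback.fst τ ψ₀) := MorphismProperty.pullback_fst _ _ hsm
    haveI : IsLocallyNoetherian (pullback τ ψ₀) := LocallyOfFiniteType.isLocallyNoetherian (pullback.fst τ ψ₀)
    have hτ' : IsBlowup (pullback.snd τ ψ₀) (C.comap ψ₀) :=
      hτ.of_isPullback_of_flat (IsPullback.of_hasPullback τ ψ₀)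
    refine ⟨pullback τ ψ₀, pullback.snd τ ψ₀ ≫ σ₀', pullback.fst τ ψ₀,
      (IsPullback.of_hasPullback τ ψ₀).paste_vert hpb₀, inferInstance, ?_⟩
    have hsupp' : ((C.comap ψ₀).support : Set Z₀') ⊆
        (⟨N₀.ideal.comap ψ₀, N₀.boundary.map (·.comap ψ₀), N₀.mult⟩ : MarkedIdeal Z₀').support := by
      intro z hz
      rw [Scheme.IdealSheafData.support_comap] at hz
      change (N₀.mult : ℕ∞) ≤ idealOrder (N₀.ideal.comap ψ₀) z
      rw [le_idealOrder_comap_iff_of_smooth]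
      exact hsupp hz
    have step := hmb.blowup (C.comap ψ₀) (pullback.snd τ ψ₀) hτ'
      (Scheme.IsRegular.subscheme_comap_of_smooth ψ₀ C hC) hsupp' (HasSNCWith.comap_of_smooth ψ₀ hsnc')
    rwa [MarkedIdeal.transform_comap_of_flat ψ₀ (pullback.condition (f := τ) (g := ψ₀)) N₀ C] at step

/-- **The smooth pull-back of a marked resolution is a marked resolution of the pulled-back marked ideal** (final
support `ψ⁻¹ ∅ = ∅`). [cite: BierstoneGrigorievMilmanWlodarczyk2011, Thm. 8.0.5 (1)–(2) with Def. 3.1.3 (6)] -/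
theorem IsMarkedResolution.exists_isPullback_of_smooth {M : MarkedIdeal X} {Z : Scheme.{u}}
    {σ : Z ⟶ X} {N : MarkedIdeal Z} (h : IsMarkedResolution M σ N) :
    ∃ (Z' : Scheme.{u}) (σ' : Z' ⟶ X') (ψ : Z' ⟶ Z), IsPullback ψ σ' σ φ ∧ Smooth ψ ∧
      IsMarkedResolution (⟨M.ideal.comap φ, M.boundary.map (·.comap φ), M.mult⟩ : MarkedIdeal X')
        σ' ⟨N.ideal.comap ψ, N.boundary.map (·.comap ψ), N.mult⟩ := by
  obtain ⟨Z', σ', ψ, hpb, hsm, hmb⟩ := IsMultipleBlowup.exists_isPullback_of_smooth φ h.1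
  refine ⟨Z', σ', ψ, hpb, hsm, hmb, ?_⟩
  haveI := hsm
  haveI : IsLocallyNoetherian Z := h.1.isLocallyNoetherian
  ext x'
  simp only [Set.mem_empty_iff_false, iff_false]
  change ¬ ((N.mult : ℕ∞) ≤ idealOrder (N.ideal.comap ψ) x')
  rw [le_idealOrder_comap_iff_of_smooth]
  have hx : ψ x' ∉ N.support := by rw [h.2]; exact Set.notMem_empty _
  exact hx

end Pullback

/-! ## §3 In the host item's words -/

/-- **THE CONCLUSION OF stmt-16156 TRANSFERS ALONG SMOOTH MORPHISMS**: if the marked ideal `(X, I, E, m)` has a BGMW marked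
resolution (`∃ X₁ Φ M′, IsMarkedResolution ⟨I, E, m⟩ Φ M′` — the literal conclusion shape of
`HypersurfaceOrderReductionDimLeThree` and of the host-shape ladder) and `φ : X′ ⟶ X` is smooth (`X` locally Noetherian),
then so does `(X′, φ^*I, φ^*E, m)`. [cite: BierstoneGrigorievMilmanWlodarczyk2011, Thm. 8.0.5] -/
theorem hostConclusion_comap_of_smooth {X' X : Scheme.{u}} (φ : X' ⟶ X) [Smooth φ] [IsLocallyNoetherian X]
    {I : X.IdealSheafData} {E : List X.IdealSheafData} {m : ℕ}
    (h : ∃ (X₁ : Scheme.{u}) (Φ : X₁ ⟶ X) (M' : MarkedIdeal X₁), IsMarkedResolution (⟨I, E, m⟩ : MarkedIdeal X) Φ M') :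
    ∃ (X₁' : Scheme.{u}) (Φ' : X₁' ⟶ X') (M'' : MarkedIdeal X₁'),
      IsMarkedResolution (⟨I.comap φ, E.map (·.comap φ), m⟩ : MarkedIdeal X') Φ' M'' := by
  obtain ⟨X₁, Φ, M', hres⟩ := h
  obtain ⟨Z', σ', ψ, -, -, hres'⟩ := IsMarkedResolution.exists_isPullback_of_smooth φ hres
  exact ⟨Z', σ', _, hres'⟩

/-- **THE TRANSFER PRINCIPLE FOR THE HOST-SHAPE LADDER `rung d ⇒ smooth pull-backs of rung-d inputs, any dimension`**:
if `HypersurfaceOrderReductionDimLE p d` holds (o1's host-shape ladder, p500045; `d = 1` proved by res-L1-s46-pv-10), then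
for every input of that rung — perfect `k` of characteristic `p`; `X` separated, locally of finite type, quasi-compact,
integral, regular, of dimension `≤ d`; `I ≠ 0` effective Cartier; `E` a simple-normal-crossings boundary — every SMOOTH
`φ : X′ ⟶ X` (any `X′`, any dimension) and every `m ≥ 1`, the pulled-back marked ideal `(X′, φ^*I, φ^*E, m)` has a BGMW
marked resolution. [cite: BierstoneGrigorievMilmanWlodarczyk2011, Thm. 8.0.5] -/
theorem hostConclusion_of_smooth_over_rung {p d : ℕ} (h : HypersurfaceOrderReductionDimLE p d) (hp : p.Prime)
    (k : Type) [Field k] [CharP k p] [PerfectField k] (X : Scheme.{0}) (s : X ⟶ Spec (.of k))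
    (hsep : IsSeparated s) (hloft : LocallyOfFiniteType s) (hqc : QuasiCompact s) (hint : IsIntegral X)
    (hreg : Scheme.IsRegular X) (hdim : topologicalKrullDim X ≤ d) (I : X.IdealSheafData) (hI : I ≠ ⊥)
    (hIc : IsEffectiveCartier I) (E : List X.IdealSheafData) (hE : HasSNC E) {X' : Scheme.{0}} (φ : X' ⟶ X)
    [Smooth φ] {m : ℕ} (hm : 1 ≤ m) :
    ∃ (X₁' : Scheme.{0}) (Φ' : X₁' ⟶ X') (M'' : MarkedIdeal X₁'),
      IsMarkedResolution (⟨I.comap φ, E.map (·.comap φ), m⟩ : MarkedIdeal X') Φ' M'' := by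
  haveI : IsLocallyNoetherian X := LocallyOfFiniteType.isLocallyNoetherian s
  exact hostConclusion_comap_of_smooth φ (h hp k X s hsep hloft hqc hint hreg hdim I hI hIc E hE m hm)

end CampaignW46

end Summit.ResolutionOfSingularities.ResolutionOfSingularities.Theorems

end
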